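import Summits.AtomisticToContinuum.FouriersLaw.Theorems.HeatModeWeylLawSpecificHeatLimitTransfer
import Mathlib.Probability.Moments.Covariance
import Mathlib.Probability.Moments.Variance
import Mathlib.Algebra.QuadraticDiscriminant
import HarnessLib

/-!
# The configurational Gibbs state of a nearest-neighbour chain: variance of the potential energy
# versus the covariances of the bond energies

Helper file for item `stmt-AtomisticToContinuum-12398` (`SpecificHeatLimit`, route `HeatModeWeylLaw`
of `AtomisticToContinuum/FouriersLaw`). For an `OscillatorChain P` with `U, V ≥ 0` continuous, `T > 0`
and `a = e^{-U/4T}` square integrable, the configurational Gibbs probability measure of the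
`(n+1)`-site chain is `ν = Z⁻¹ e^{-Φ_{n+1}(q)/T} dq`. Writing `Φ_{n+1} = S + R`,
`S = ∑_{i<n} h(qᵢ, qᵢ₊₁)`, `R = (U(q₀) + U(qₙ))/2` (`…Transfer.lean`), this file PROVES:

* `abs_covariance_le_sqrt` — Cauchy–Schwarz `|cov[X, Y]| ≤ √(Var X · Var Y)` (Mathlib's
  `variance_add` + `discrim_le_zero`);
* `integrable_weight_mul_of_le` — every measurable `G` with `|G| ≤ C (1 + Φ)²` is integrable against
  `e^{-Φ/T} dq` (domination by `∏ a(qᵢ)²`);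
* `confMeasure_isProbabilityMeasure`, `integral_confMeasure`, `memLp_confMeasure_of_le` — `ν` is a
  probability measure, `∫ F dν = (∫ F e^{-Φ/T})/Z`, and `|G| ≤ C(1 + Φ)` ⇒ `G ∈ L²(ν)`;
* `abs_variance_potential_sub_sum_cov_le` (**main**) —
  `|Var_ν(Φ_{n+1}) - ∑_{i,j<n} cov_ν(hᵢ, hⱼ)| ≤ K + 2 √(K ∑ cov)` with
  `K = (𝔼_ν U(q₀)² + 𝔼_ν U(qₙ)²)/2`, and `∑_{i,j} cov_ν(hᵢ, hⱼ) = Var_ν(S) ≥ 0`.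

All [folklore]; no definitions (`ν` enters through a defining hypothesis).
-/

noncomputable section

open MeasureTheory ProbabilityTheory Set Filter Function
open scoped RealInnerProductSpace ENNReal

namespace Summit.AtomisticToContinuum.FouriersLaw.Theorems.SpecificHeatLimit

open Literature.MathematicalPhysics.KineticTheory.HeatConduction

/-! ### Cauchy–Schwarz for the covariance -/

/-- **Cauchy–Schwarz**: `|cov[X, Y]| ≤ √(Var[X] Var[Y])` for `X, Y ∈ L²` of a probability measure
(the quadratic `t ↦ Var[X + tY] ≥ 0` has nonpositive discriminant). [folklore] -/
theorem abs_covariance_le_sqrt {Ω : Type*} [MeasurableSpace Ω] {μ : Measure Ω}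
    [IsProbabilityMeasure μ] {X Y : Ω → ℝ} (hX : MemLp X 2 μ) (hY : MemLp Y 2 μ) :
    |cov[X, Y; μ]| ≤ Real.sqrt (Var[X; μ] * Var[Y; μ]) := by
  have h : ∀ t : ℝ, 0 ≤ Var[Y; μ] * (t * t) + (2 * cov[X, Y; μ]) * t + Var[X; μ] := by
    intro t
    have h1 := variance_nonneg (X + t • Y) μ
    rw [variance_add hX (hY.const_smul t), covariance_smul_right, variance_smul] at h1
    nlinarith [h1]
  have hd := discrim_le_zero h
  rw [discrim] at hd
  have hsq : cov[X, Y; μ] ^ 2 ≤ Var[X; μ] * Var[Y; μ] := by nlinarith [hd]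
  calc |cov[X, Y; μ]| = Real.sqrt (cov[X, Y; μ] ^ 2) := (Real.sqrt_sq_eq_abs _).symm
    _ ≤ Real.sqrt (Var[X; μ] * Var[Y; μ]) := Real.sqrt_le_sqrt hsq

/-! ### The pieces of the potential energy: signs and continuity -/

section Pieces

variable {P : OscillatorChain} (hU0 : ∀ x, 0 ≤ P.U x) (hV0 : ∀ r, 0 ≤ P.V r)
  {h : ℝ → ℝ → ℝ} (hh : ∀ x y, h x y = (P.U x + P.U y) / 2 + P.V (y - x))

include hU0 hV0 hh in
/-- `h ≥ 0`. [folklore] -/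
theorem bondEnergy_nonneg (x y : ℝ) : 0 ≤ h x y := by
  rw [hh]; exact add_nonneg (by linarith [hU0 x, hU0 y]) (hV0 _)

include hU0 hV0 hh in
/-- `0 ≤ hᵢ ≤ Φ`, `0 ≤ (U(q₀) + U(qₙ))/2 ≤ Φ`, `0 ≤ ∑ hᵢ ≤ Φ`, `0 ≤ Φ` for the `(n+1)`-site chain.
[folklore] -/
theorem pieces_le_potential (n : ℕ) (q : Fin (n + 1) → ℝ) :
    (∀ i : Fin n, h (q (Fin.castSucc i)) (q i.succ) ≤ P.potential (n + 1) q) ∧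
    (P.U (q 0) + P.U (q (Fin.last n))) / 2 ≤ P.potential (n + 1) q ∧
    (∑ i : Fin n, h (q (Fin.castSucc i)) (q i.succ)) ≤ P.potential (n + 1) q ∧
    0 ≤ ∑ i : Fin n, h (q (Fin.castSucc i)) (q i.succ) ∧
    0 ≤ (P.U (q 0) + P.U (q (Fin.last n))) / 2 ∧ 0 ≤ P.potential (n + 1) q := by
  have hΦ := potential_succ_eq_bondSum P n q hh
  have hS : 0 ≤ ∑ i : Fin n, h (q (Fin.castSucc i)) (q i.succ) :=
    Finset.sum_nonneg fun i _ => bondEnergy_nonneg hU0 hV0 hh _ _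
  have hR : 0 ≤ (P.U (q 0) + P.U (q (Fin.last n))) / 2 := by linarith [hU0 (q 0), hU0 (q (Fin.last n))]
  refine ⟨fun i => ?_, by linarith, by linarith, hS, hR, by linarith⟩
  have : h (q (Fin.castSucc i)) (q i.succ) ≤ ∑ j : Fin n, h (q (Fin.castSucc j)) (q j.succ) :=
    Finset.single_le_sum (f := fun j => h (q (Fin.castSucc j)) (q j.succ))
      (fun j _ => bondEnergy_nonneg hU0 hV0 hh _ _) (Finset.mem_univ i)
  linarith

/-- `Φ_{n+1}` is continuous for continuous potentials. [folklore] -/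
theorem continuous_potential_succ (hUc : Continuous P.U) (hVc : Continuous P.V) (n : ℕ) :
    Continuous (P.potential (n + 1)) := by
  have : P.potential (n + 1) = fun q => (∑ i : Fin (n + 1), P.U (q i)) +
      ∑ i : Fin n, P.V (q i.succ - q (Fin.castSucc i)) := funext (potential_succ_eq P n)
  rw [this]
  refine (continuous_finsetSum _ fun i _ => hUc.comp (continuous_apply i)).add
    (continuous_finsetSum _ fun i _ => hVc.comp ((continuous_apply _).sub (continuous_apply _)))

include hh in
/-- The bond energies `q ↦ h(qᵢ, qᵢ₊₁)` are continuous. [folklore] -/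
theorem continuous_bondEnergy (hUc : Continuous P.U) (hVc : Continuous P.V) (n : ℕ) (i : Fin n) :
    Continuous fun q : Fin (n + 1) → ℝ => h (q (Fin.castSucc i)) (q i.succ) := by
  have : (fun q : Fin (n + 1) → ℝ => h (q (Fin.castSucc i)) (q i.succ)) = fun q =>
      (P.U (q (Fin.castSucc i)) + P.U (q i.succ)) / 2 + P.V (q i.succ - q (Fin.castSucc i)) :=
    funext fun q => hh _ _
  rw [this]
  exact (((hUc.comp (continuous_apply _)).add (hUc.comp (continuous_apply _))).div_const _).add
    (hVc.comp ((continuous_apply _).sub (continuous_apply _)))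

end Pieces

/-! ### Integrability against the Boltzmann weight -/

section Weight

variable {P : OscillatorChain} {T : ℝ} {a : ℝ → ℝ}

/-- **Integrability against `e^{-Φ/T} dq`.** For `T > 0`, `U, V ≥ 0` continuous, `a = e^{-U/4T}` with
`a²` integrable, every a.e. strongly measurable `G` with `|G| ≤ C (1 + Φ_{n+1})²` satisfies
`G e^{-Φ_{n+1}/T} ∈ L¹(dq)`: `(1 + Φ)² e^{-Φ/2T} ≤ 2 + 32T²` and `e^{-Φ/2T} ≤ ∏ᵢ a(qᵢ)²` (`V ≥ 0`).
[folklore] -/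
theorem integrable_weight_mul_of_le (hT : 0 < T) (hU0 : ∀ x, 0 ≤ P.U x) (hV0 : ∀ r, 0 ≤ P.V r)
    (hUc : Continuous P.U) (hVc : Continuous P.V) (ha : ∀ x, a x = Real.exp (-P.U x / (4 * T)))
    (hint : Integrable fun x => a x ^ 2) (n : ℕ) {G : (Fin (n + 1) → ℝ) → ℝ}
    (hGm : AEStronglyMeasurable G volume) {C : ℝ}
    (hG : ∀ q, |G q| ≤ C * (1 + P.potential (n + 1) q) ^ 2) :
    Integrable fun q => G q * Real.exp (-P.potential (n + 1) q / T) := by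
  set Φ := P.potential (n + 1) with hΦ
  have hΦ0 : ∀ q, 0 ≤ Φ q := fun q => by
    rw [hΦ, potential_succ_eq]
    exact add_nonneg (Finset.sum_nonneg fun i _ => hU0 _) (Finset.sum_nonneg fun i _ => hV0 _)
  have hC : 0 ≤ C := by
    have h1 := hG (fun _ => 0)
    have h2 : 0 < (1 + Φ fun _ => 0) ^ 2 := by have := hΦ0 (fun _ => 0); positivity
    nlinarith [abs_nonneg (G fun _ => 0)]
  -- `(1 + x)² e^{-x/2T} ≤ K`
  set K : ℝ := 2 + 32 * T ^ 2 with hK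
  have hpoly : ∀ x : ℝ, 0 ≤ x → (1 + x) ^ 2 * Real.exp (-x / (2 * T)) ≤ K := by
    intro x hx
    have h1 : x ^ 2 * Real.exp (-x / (2 * T)) ≤ 4 * (2 * T) ^ 2 := by
      -- `x² e^{-x/c} ≤ 4c²` with `c = 2T`
      have hc : (0 : ℝ) < 2 * T := by positivity
      have hb : x * Real.exp (-x / (2 * (2 * T))) ≤ 2 * (2 * T) := by
        have h2 : x / (2 * (2 * T)) + 1 ≤ Real.exp (x / (2 * (2 * T))) := Real.add_one_le_exp _
        rw [neg_div, Real.exp_neg]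
        have h3 : 0 < Real.exp (x / (2 * (2 * T))) := Real.exp_pos _
        rw [mul_inv_le_iff₀ h3]
        have h4 : x / (2 * (2 * T)) ≤ Real.exp (x / (2 * (2 * T))) := by linarith
        rw [div_le_iff₀ (by positivity)] at h4
        linarith
      have e : x ^ 2 * Real.exp (-x / (2 * T)) = (x * Real.exp (-x / (2 * (2 * T)))) ^ 2 := by
        rw [mul_pow, ← Real.exp_nat_mul]; congr 2; push_cast; field_simp
      rw [e]
      have h0 : 0 ≤ x * Real.exp (-x / (2 * (2 * T))) := by positivity
      nlinarith
    have h2 : Real.exp (-x / (2 * T)) ≤ 1 := by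
      rw [Real.exp_le_one_iff, neg_div]; exact neg_nonpos.2 (div_nonneg hx (by positivity))
    have h3 : (1 + x) ^ 2 ≤ 2 + 2 * x ^ 2 := by nlinarith [sq_nonneg (x - 1)]
    calc (1 + x) ^ 2 * Real.exp (-x / (2 * T)) ≤ (2 + 2 * x ^ 2) * Real.exp (-x / (2 * T)) := by
          gcongr
      _ = 2 * Real.exp (-x / (2 * T)) + 2 * (x ^ 2 * Real.exp (-x / (2 * T))) := by ring
      _ ≤ 2 * 1 + 2 * (4 * (2 * T) ^ 2) := by gcongr
      _ = K := by rw [hK]; ring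
  -- `e^{-Φ/2T} ≤ ∏ a(qᵢ)²`
  have ha2 : ∀ x, a x ^ 2 = Real.exp (-P.U x / (2 * T)) := fun x => by
    rw [ha, ← Real.exp_nat_mul]; congr 1; push_cast; field_simp; ring
  have hdom : ∀ q : Fin (n + 1) → ℝ, Real.exp (-Φ q / (2 * T)) ≤ ∏ i, a (q i) ^ 2 := by
    intro q
    simp_rw [ha2]
    rw [← Real.exp_sum, Real.exp_le_exp, hΦ, potential_succ_eq, neg_div]
    rw [show (∑ i : Fin (n + 1), -P.U (q i) / (2 * T)) = -((∑ i : Fin (n + 1), P.U (q i)) / (2 * T)) by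
      rw [Finset.sum_div, ← Finset.sum_neg_distrib]; exact Finset.sum_congr rfl fun i _ => by ring]
    rw [neg_le_neg_iff]
    exact div_le_div_of_nonneg_right
      (le_add_of_nonneg_right (Finset.sum_nonneg fun i _ => hV0 _)) (by positivity)
  -- the dominating integrable function
  have ham : Measurable a := by
    have : a = fun x => Real.exp (-P.U x / (4 * T)) := funext ha
    rw [this]; exact Real.measurable_exp.comp ((hUc.measurable.neg).div_const _)
  have hprod : Integrable fun q : Fin (n + 1) → ℝ => ∏ i, a (q i) ^ 2 := by
    have := Integrable.fintype_prod (f := fun (_ : Fin (n + 1)) (s : ℝ) => a s ^ 2) fun _ => hint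
    simpa only [volume_pi] using this
  refine (hprod.const_mul (C * K)).mono' ?_ (Eventually.of_forall fun q => ?_)
  · exact hGm.mul (Real.continuous_exp.comp (((continuous_potential_succ hUc hVc n).neg).div_const
      _)).aestronglyMeasurable
  · rw [Real.norm_eq_abs, abs_mul, abs_of_pos (Real.exp_pos _)]
    have hsplit : Real.exp (-Φ q / T) = Real.exp (-Φ q / (2 * T)) * Real.exp (-Φ q / (2 * T)) := by
      rw [← Real.exp_add]; congr 1; field_simp; ring
    have h1 : (1 : ℝ) ≤ (1 + Φ q) ^ 2 := by nlinarith [hΦ0 q]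
    have hK0 : 0 ≤ K := by rw [hK]; positivity
    calc |G q| * Real.exp (-Φ q / T) ≤ C * (1 + Φ q) ^ 2 * Real.exp (-Φ q / T) :=
          mul_le_mul_of_nonneg_right (hG q) (Real.exp_pos _).le
      _ = C * (((1 + Φ q) ^ 2 * Real.exp (-Φ q / (2 * T))) * Real.exp (-Φ q / (2 * T))) := by
          rw [hsplit]; ring
      _ ≤ C * (K * ∏ i, a (q i) ^ 2) :=
          mul_le_mul_of_nonneg_left (mul_le_mul (hpoly _ (hΦ0 q)) (hdom q) (Real.exp_pos _).le hK0) hC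
      _ = C * K * ∏ i, a (q i) ^ 2 := by ring

end Weight

/-! ### The configurational probability measure `ν = Z⁻¹ e^{-Φ/T} dq` -/

section ConfMeasure

variable {P : OscillatorChain} {T : ℝ} {a : ℝ → ℝ} {h : ℝ → ℝ → ℝ} {n : ℕ}
  {ν : Measure (Fin (n + 1) → ℝ)}

/-- **`ν` is a probability measure and `∫ F dν = (∫ F e^{-Φ/T} dq) / Z`** (`Z = ∫ e^{-Φ/T} dq > 0`).
[folklore] -/
theorem confMeasure_spec (hT : 0 < T) (hU0 : ∀ x, 0 ≤ P.U x) (hV0 : ∀ r, 0 ≤ P.V r)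
    (hUc : Continuous P.U) (hVc : Continuous P.V) (ha : ∀ x, a x = Real.exp (-P.U x / (4 * T)))
    (hint : Integrable fun x => a x ^ 2)
    (hν : ν = (ENNReal.ofReal (∫ q : Fin (n + 1) → ℝ, Real.exp (-P.potential (n + 1) q / T)))⁻¹ •
      volume.withDensity fun q => ENNReal.ofReal (Real.exp (-P.potential (n + 1) q / T))) :
    IsProbabilityMeasure ν ∧ 0 < ∫ q : Fin (n + 1) → ℝ, Real.exp (-P.potential (n + 1) q / T) ∧
    (∀ F : (Fin (n + 1) → ℝ) → ℝ, ∫ q, F q ∂ν =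
      (∫ q, F q * Real.exp (-P.potential (n + 1) q / T)) /
        ∫ q : Fin (n + 1) → ℝ, Real.exp (-P.potential (n + 1) q / T)) ∧
    (∀ G : (Fin (n + 1) → ℝ) → ℝ, Integrable (fun q => G q * Real.exp (-P.potential (n + 1) q / T)) →
      Integrable G ν) := by
  set w : (Fin (n + 1) → ℝ) → ℝ := fun q => Real.exp (-P.potential (n + 1) q / T) with hw
  set Z : ℝ := ∫ q, w q with hZ
  have hwc : Continuous w :=
    Real.continuous_exp.comp (((continuous_potential_succ hUc hVc n).neg).div_const _)
  have hwm : Measurable fun q => ENNReal.ofReal (w q) := hwc.measurable.ennreal_ofReal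
  have hΦ0 : ∀ q, 0 ≤ P.potential (n + 1) q := fun q => by
    rw [potential_succ_eq]
    exact add_nonneg (Finset.sum_nonneg fun i _ => hU0 _) (Finset.sum_nonneg fun i _ => hV0 _)
  have hwint : Integrable w := by
    have := integrable_weight_mul_of_le hT hU0 hV0 hUc hVc ha hint n (G := fun _ => (1 : ℝ))
      aestronglyMeasurable_const (C := 1) (fun q => by
        rw [abs_one, one_mul]; nlinarith [hΦ0 q])
    simpa only [one_mul] using this
  have hZpos : 0 < Z := by
    haveI : NeZero (volume : Measure (Fin (n + 1) → ℝ)) := inferInstance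
    exact integral_exp_pos hwint
  have hZ0 : ENNReal.ofReal Z ≠ 0 := (ENNReal.ofReal_pos.2 hZpos).ne'
  have hμuniv : (volume.withDensity fun q => ENNReal.ofReal (w q)) univ = ENNReal.ofReal Z := by
    rw [withDensity_apply _ MeasurableSet.univ, Measure.restrict_univ, hZ,
      ofReal_integral_eq_lintegral_ofReal hwint (Eventually.of_forall fun q => (Real.exp_pos _).le)]
  have hprob : IsProbabilityMeasure ν := ⟨by
    rw [hν, Measure.smul_apply, smul_eq_mul, hμuniv, ENNReal.inv_mul_cancel hZ0 ENNReal.ofReal_ne_top]⟩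
  have hformula : ∀ F : (Fin (n + 1) → ℝ) → ℝ, ∫ q, F q ∂ν = (∫ q, F q * w q) / Z := by
    intro F
    rw [hν, integral_smul_measure, integral_withDensity_eq_integral_toReal_smul hwm
      (Eventually.of_forall fun q => ENNReal.ofReal_lt_top), ENNReal.toReal_inv,
      ENNReal.toReal_ofReal hZpos.le, smul_eq_mul, div_eq_inv_mul]
    congr 1
    refine integral_congr_ae (Eventually.of_forall fun q => ?_)
    dsimp only
    rw [ENNReal.toReal_ofReal (Real.exp_pos _).le, smul_eq_mul, mul_comm]
  refine ⟨hprob, hZpos, hformula, fun G hG => ?_⟩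
  rw [hν]
  refine Integrable.smul_measure ?_ (ENNReal.inv_ne_top.2 hZ0)
  rw [integrable_withDensity_iff_integrable_smul' hwm (Eventually.of_forall fun q => ENNReal.ofReal_lt_top)]
  refine hG.congr (Eventually.of_forall fun q => ?_)
  dsimp only
  rw [ENNReal.toReal_ofReal (Real.exp_pos _).le, smul_eq_mul, mul_comm]

/-- **`L²(ν)` membership**: a continuous `G` with `|G| ≤ C (1 + Φ)` is in `L²(ν)`. [folklore] -/
theorem memLp_confMeasure_of_le (hT : 0 < T) (hU0 : ∀ x, 0 ≤ P.U x) (hV0 : ∀ r, 0 ≤ P.V r)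
    (hUc : Continuous P.U) (hVc : Continuous P.V) (ha : ∀ x, a x = Real.exp (-P.U x / (4 * T)))
    (hint : Integrable fun x => a x ^ 2)
    (hν : ν = (ENNReal.ofReal (∫ q : Fin (n + 1) → ℝ, Real.exp (-P.potential (n + 1) q / T)))⁻¹ •
      volume.withDensity fun q => ENNReal.ofReal (Real.exp (-P.potential (n + 1) q / T)))
    {G : (Fin (n + 1) → ℝ) → ℝ} (hGc : Continuous G) {C : ℝ}
    (hG : ∀ q, |G q| ≤ C * (1 + P.potential (n + 1) q)) : MemLp G 2 ν := by
  obtain ⟨hprob, -, -, hintegrable⟩ := confMeasure_spec hT hU0 hV0 hUc hVc ha hint hν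
  rw [memLp_two_iff_integrable_sq hGc.aestronglyMeasurable]
  refine hintegrable _ (integrable_weight_mul_of_le hT hU0 hV0 hUc hVc ha hint n
    ((hGc.pow 2).aestronglyMeasurable) (C := C ^ 2) fun q => ?_)
  rw [abs_pow, ← mul_pow]
  have hΦ0 : 0 ≤ P.potential (n + 1) q := by
    rw [potential_succ_eq]
    exact add_nonneg (Finset.sum_nonneg fun i _ => hU0 _) (Finset.sum_nonneg fun i _ => hV0 _)
  have hC : 0 ≤ C * (1 + P.potential (n + 1) q) := (abs_nonneg _).trans (hG q)
  exact pow_le_pow_left₀ (abs_nonneg _) (hG q) 2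

/-- **The variance of the potential energy versus the bond-energy covariances.** For the
configurational Gibbs probability measure `ν = Z⁻¹ e^{-Φ_{n+1}/T} dq` of a chain with `U, V ≥ 0`
continuous (`T > 0`, `a²` integrable) and the bond energies `hᵢ(q) = h(qᵢ, qᵢ₊₁)`,
`h(x, y) = (U(x) + U(y))/2 + V(y - x)`: the double sum `∑ᵢ ∑ⱼ cov_ν(hᵢ, hⱼ) = Var_ν(∑ hᵢ)` is
nonnegative, each `cov_ν(hᵢ, hⱼ) = 𝔼_ν[hᵢ hⱼ] - 𝔼_ν[hᵢ] 𝔼_ν[hⱼ]`, and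
`|Var_ν(Φ_{n+1}) - ∑ᵢ ∑ⱼ cov_ν(hᵢ, hⱼ)| ≤ K + 2 √(K · ∑ᵢ ∑ⱼ cov_ν(hᵢ, hⱼ))` with
`K = (𝔼_ν[U(q₀)²] + 𝔼_ν[U(qₙ)²])/2` — since `Φ_{n+1} = ∑ hᵢ + R`, `R = (U(q₀) + U(qₙ))/2`,
`Var R ≤ 𝔼 R² ≤ K`, and Cauchy–Schwarz bounds the cross covariance. [folklore] -/
theorem abs_variance_potential_sub_sum_cov_le (hT : 0 < T) (hU0 : ∀ x, 0 ≤ P.U x)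
    (hV0 : ∀ r, 0 ≤ P.V r) (hUc : Continuous P.U) (hVc : Continuous P.V)
    (ha : ∀ x, a x = Real.exp (-P.U x / (4 * T))) (hint : Integrable fun x => a x ^ 2)
    (hh : ∀ x y, h x y = (P.U x + P.U y) / 2 + P.V (y - x))
    (hν : ν = (ENNReal.ofReal (∫ q : Fin (n + 1) → ℝ, Real.exp (-P.potential (n + 1) q / T)))⁻¹ •
      volume.withDensity fun q => ENNReal.ofReal (Real.exp (-P.potential (n + 1) q / T))) :
    0 ≤ ∑ i : Fin n, ∑ j : Fin n, cov[fun q => h (q (Fin.castSucc i)) (q i.succ),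
        fun q => h (q (Fin.castSucc j)) (q j.succ); ν] ∧
    (∀ i j : Fin n, cov[fun q => h (q (Fin.castSucc i)) (q i.succ),
        fun q => h (q (Fin.castSucc j)) (q j.succ); ν] =
      (∫ q, h (q (Fin.castSucc i)) (q i.succ) * h (q (Fin.castSucc j)) (q j.succ) ∂ν) -
        (∫ q, h (q (Fin.castSucc i)) (q i.succ) ∂ν) * ∫ q, h (q (Fin.castSucc j)) (q j.succ) ∂ν) ∧
    |Var[P.potential (n + 1); ν] - ∑ i : Fin n, ∑ j : Fin n,
        cov[fun q => h (q (Fin.castSucc i)) (q i.succ), fun q => h (q (Fin.castSucc j)) (q j.succ); ν]| ≤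
      ((∫ q, P.U (q 0) ^ 2 ∂ν) + ∫ q, P.U (q (Fin.last n)) ^ 2 ∂ν) / 2 +
        2 * Real.sqrt ((∑ i : Fin n, ∑ j : Fin n, cov[fun q => h (q (Fin.castSucc i)) (q i.succ),
          fun q => h (q (Fin.castSucc j)) (q j.succ); ν]) *
          (((∫ q, P.U (q 0) ^ 2 ∂ν) + ∫ q, P.U (q (Fin.last n)) ^ 2 ∂ν) / 2)) := by
  obtain ⟨hprob, hZpos, hformula, hintegrable⟩ := confMeasure_spec hT hU0 hV0 hUc hVc ha hint hν
  have hmem := fun {G : (Fin (n + 1) → ℝ) → ℝ} (hGc : Continuous G) {C : ℝ}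
      (hG : ∀ q, |G q| ≤ C * (1 + P.potential (n + 1) q)) =>
    memLp_confMeasure_of_le hT hU0 hV0 hUc hVc ha hint hν hGc hG
  -- the pieces
  set Φ : (Fin (n + 1) → ℝ) → ℝ := P.potential (n + 1) with hΦ
  set hi : Fin n → (Fin (n + 1) → ℝ) → ℝ := fun i q => h (q (Fin.castSucc i)) (q i.succ) with hhi
  set S : (Fin (n + 1) → ℝ) → ℝ := fun q => ∑ i : Fin n, hi i q with hS
  set R : (Fin (n + 1) → ℝ) → ℝ := fun q => (P.U (q 0) + P.U (q (Fin.last n))) / 2 with hR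
  have hpieces := fun q => pieces_le_potential hU0 hV0 hh n q
  have hΦSR : Φ = S + R := by
    funext q; rw [Pi.add_apply, hΦ, hS, hR]; exact potential_succ_eq_bondSum P n q hh
  have hSsum : S = ∑ i : Fin n, hi i := by funext q; rw [hS, Finset.sum_apply]
  -- continuity
  have hΦc : Continuous Φ := continuous_potential_succ hUc hVc n
  have hhic : ∀ i, Continuous (hi i) := fun i => continuous_bondEnergy hh hUc hVc n i
  have hRc : Continuous R :=
    ((hUc.comp (continuous_apply 0)).add (hUc.comp (continuous_apply _))).div_const _
  have hSc : Continuous S := by rw [hS]; exact continuous_finsetSum _ fun i _ => hhic i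
  -- `L²` membership
  have hΦm : MemLp Φ 2 ν := hmem hΦc (C := 1) fun q => by
    rw [abs_of_nonneg (hpieces q).2.2.2.2.2]; linarith [(hpieces q).2.2.2.2.2]
  have hhim : ∀ i, MemLp (hi i) 2 ν := fun i => hmem (hhic i) (C := 1) fun q => by
    rw [hhi]; dsimp only
    rw [abs_of_nonneg (bondEnergy_nonneg hU0 hV0 hh _ _)]
    linarith [(hpieces q).1 i, (hpieces q).2.2.2.2.2]
  have hRm : MemLp R 2 ν := hmem hRc (C := 1) fun q => by
    rw [hR]; dsimp only
    rw [abs_of_nonneg (hpieces q).2.2.2.2.1]; linarith [(hpieces q).2.1, (hpieces q).2.2.2.2.2]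
  have hSm : MemLp S 2 ν := hmem hSc (C := 1) fun q => by
    rw [hS]; dsimp only
    rw [abs_of_nonneg (hpieces q).2.2.2.1]; linarith [(hpieces q).2.2.1, (hpieces q).2.2.2.2.2]
  have hU0m : MemLp (fun q : Fin (n + 1) → ℝ => P.U (q 0)) 2 ν :=
    hmem (hUc.comp (continuous_apply 0)) (C := 2) fun q => by
      rw [abs_of_nonneg (hU0 _)]
      linarith [(hpieces q).2.1, (hpieces q).2.2.2.2.2, hU0 (q (Fin.last n))]
  have hUnm : MemLp (fun q : Fin (n + 1) → ℝ => P.U (q (Fin.last n))) 2 ν :=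
    hmem (hUc.comp (continuous_apply _)) (C := 2) fun q => by
      rw [abs_of_nonneg (hU0 _)]
      linarith [(hpieces q).2.1, (hpieces q).2.2.2.2.2, hU0 (q 0)]
  -- `Var S = ∑∑ cov`
  have hVarS : Var[S; ν] = ∑ i : Fin n, ∑ j : Fin n, cov[hi i, hi j; ν] := by
    rw [← covariance_self hSm.aemeasurable, hSsum]
    exact covariance_sum_sum (fun i => hhim i) (fun i => hhim i)
  refine ⟨?_, fun i j => ?_, ?_⟩
  · rw [← hVarS]; exact variance_nonneg _ _
  · have := covariance_eq_sub (hhim i) (hhim j)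
    simpa only [hhi, Pi.mul_apply] using this
  · -- `Var Φ = Var S + 2 cov(S, R) + Var R`
    have hVarΦ : Var[Φ; ν] = Var[S; ν] + 2 * cov[S, R; ν] + Var[R; ν] := by
      rw [hΦSR]; exact variance_add hSm hRm
    -- `Var R ≤ K`
    set KR : ℝ := ((∫ q, P.U (q 0) ^ 2 ∂ν) + ∫ q, P.U (q (Fin.last n)) ^ 2 ∂ν) / 2 with hKR
    have hU0i : Integrable (fun q : Fin (n + 1) → ℝ => P.U (q 0) ^ 2) ν := hU0m.integrable_sq
    have hUni : Integrable (fun q : Fin (n + 1) → ℝ => P.U (q (Fin.last n)) ^ 2) ν := hUnm.integrable_sq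
    have hVarR : Var[R; ν] ≤ KR := by
      calc Var[R; ν] ≤ ∫ q, (R ^ 2) q ∂ν := variance_le_expectation_sq hRc.aestronglyMeasurable
        _ ≤ ∫ q, (P.U (q 0) ^ 2 + P.U (q (Fin.last n)) ^ 2) / 2 ∂ν := by
            refine integral_mono hRm.integrable_sq ((hU0i.add hUni).div_const 2) fun q => ?_
            simp only [Pi.pow_apply, hR]
            nlinarith [sq_nonneg (P.U (q 0) - P.U (q (Fin.last n)))]
        _ = KR := by
            rw [hKR, integral_div, integral_add hU0i hUni]
    have hKR0 : 0 ≤ KR := (variance_nonneg _ _).trans hVarR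
    -- Cauchy–Schwarz for the cross term
    have hcov : |cov[S, R; ν]| ≤ Real.sqrt (Var[S; ν] * KR) := by
      calc |cov[S, R; ν]| ≤ Real.sqrt (Var[S; ν] * Var[R; ν]) := abs_covariance_le_sqrt hSm hRm
        _ ≤ Real.sqrt (Var[S; ν] * KR) := by
            gcongr
            · exact variance_nonneg _ _
    rw [hVarΦ, hVarS]
    rw [hVarS] at hcov
    have e : ∑ i : Fin n, ∑ j : Fin n, cov[hi i, hi j; ν] + 2 * cov[S, R; ν] + Var[R; ν] -
        ∑ i : Fin n, ∑ j : Fin n, cov[hi i, hi j; ν] = 2 * cov[S, R; ν] + Var[R; ν] := by ring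
    rw [e]
    calc |2 * cov[S, R; ν] + Var[R; ν]| ≤ |2 * cov[S, R; ν]| + |Var[R; ν]| := abs_add_le _ _
      _ = 2 * |cov[S, R; ν]| + Var[R; ν] := by
          rw [abs_mul, abs_two, abs_of_nonneg (variance_nonneg _ _)]
      _ ≤ 2 * Real.sqrt ((∑ i : Fin n, ∑ j : Fin n, cov[hi i, hi j; ν]) * KR) + KR := by
          gcongr
      _ = KR + 2 * Real.sqrt ((∑ i : Fin n, ∑ j : Fin n, cov[hi i, hi j; ν]) * KR) := by ring

end ConfMeasure

end Summit.AtomisticToContinuum.FouriersLaw.Theorems.SpecificHeatLimit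

end
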